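import Literature.MathematicalPhysics.QuantumFieldTheory.Balaban1985CMP102.SectC

/-!
# `Summit.QuantumFields.Balaban3D.Proofs.SectABound55` — [Balaban1985UV3] Sect. A, the k = 0 instance of the display chain
# behind LQB's leaf `Bound55` ((22) p. 261): at k = 0 the display (58) is an identity, so `StepLeaves.bound55` at k = 0
# follows from the two Sect. A displays (8)–(10) (↦ `SectC.Ineq48_49` at k = 0) and (13)–(22) (↦ `SectC.Ineq55` at k = 0)
# — lane `pub-balaban3d`, seat p4 (PLAN.md §3.1 l.138 «`Bound55`/`Bound55Lower` reduced to binder statements»)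

HONEST FRAMING (lane PLAN.md §0, binding): see `…Proofs.SectAFirstStep`.  Nothing of [Balaban1985UV3] is asserted; this is
[folklore] exponent bookkeeping over LQB's carrier `B10.TowerRun` and the spine's `SectC.StepDisplays` (typer-2), kernel-checked.

WHAT IS PRINTED (journal page = PDF page + 254).  p. 267 = PDF 13 L35–36 (Sect. C): «Now we do the same operations as in the
first step.» — the Sect. C displays (48)–(49), (51), (55), (58) are the step-k forms of Sect. A's (8)–(10) p. 258, (13)+(18)
pp. 259–260, (22) p. 261, (24) p. 262; the spine types the former over `SectC.StepDisplays T k` for EVERY k, so at k = 0 they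
ARE the Sect. A displays: `Ineq48_49 S₀` = «(Tρ₀)(V) = Σ_{Ω₁} (T(ρ₀ζ_{Ω₁ᶜ}χ_{Ω₁}))(V)» (8) with (9)–(10) (the V₀-integral over
Ω₁ᶜ = `outer48`, the U′-integral over Ω₁ of (10) = `I49`); `Ineq55 S₀ γ` = (13) → (18) → (22) first member («we obtain (22)»,
p. 261 L18–24: prefactor «exp[−(1/g₀²)A(U₁) + log Z^{(0)}(Ω₁, U₁) − E + log σ₀|Ω₁*| + d(𝔤) log g₀|Ω₁*|]» times the
fluctuation integral `Fl55` = «∫dμ_{C^{(0)}(Ω₁,U₁)}(A)χ exp[v(g₀A) − (1/g₀²)Ṽ(g₀A)]»); and (58) at k = 0 has NO previous-scale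
terms («Σ_{j=1}^{k} Σ_{Y_j} 𝒫_j» empty), NO «constants in (41)» (Z-terms and remainders of (41)₀ are empty sums) and its
integral IS the fluctuation integral of (22) (`Fl55 = exp logFl`), i.e. (58)₀ is an identity.

WHAT THIS FILE PROVES (no `sorry`, axioms standard):
* `Step0Displays S` — the four k = 0 identifications just listed, as a `Prop`-valued contract on `S : SectC.StepDisplays T 0`;
* `ineq58_step0 : Step0Displays S → SectC.Ineq58 S`;
* `bound55_step0_of_displays : Step0Displays S → T.g 0 ≤ γ → Ineq48_49 S → Ineq55 S γ → Bound55 S.toStepPieces` (=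
  `SectC.bound55_of_displays` at k = 0 with (58)₀ discharged) — so the lane's `StepLeaves (run3 …) 0 .bound55` needs exactly
  the two Sect. A displays (8)–(10) and (13)–(22) for the concrete carriers (modulo b7, b8, b11: their printed proofs),
  nothing else.
NOT HERE: proofs of (8)–(10) / (13)–(22) for `run3` (this seat, STEP-4, after `Carriers/`); the lower twin `Bound55Lower` at
k = 0 ((37) p. 265 L25–31 is ONE printed sentence «we perform the same operations on the whole lattice as on the sets Ω₁» —
LQB keeps it a leaf, the spine types no finer lower displays, so there is nothing to knit below it).
-/

namespace Summit.QuantumFields.Balaban3D.Proofs.SectABound55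

open Literature.MathematicalPhysics.QuantumFieldTheory.Balaban1983to89
open Literature.MathematicalPhysics.QuantumFieldTheory.Balaban1983to89.B10 (TowerRun Ineq41)
open Literature.MathematicalPhysics.QuantumFieldTheory.Balaban1983to89.B10SectAGathering (Bound55)
open Literature.MathematicalPhysics.QuantumFieldTheory.Balaban1985CMP102.SectC
  (StepDisplays Ineq48_49 Ineq55 Ineq58 bound55_of_displays)

variable {T : TowerRun}

/-- THE k = 0 IDENTIFICATIONS of the step displays (`S : SectC.StepDisplays T 0`, the Sect. A step 0 → 1): (i) `pold_zero` —
(58) p. 270 L23 «Σ_{j=1}^{k} Σ_{Y_j} 𝒫_j(Y_j, U_{k+1})» is the empty sum at k = 0 (LQB `StepPieces.Pold`: «both 0 at k = 0»);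
(ii) `zterm_proj_zero` — «(the constants in (41))» of (55)/(58): the Z-terms «Σ_{j=0}^{k−1} O(log g_j⁻¹)|Z_j|» of (41)₀ are the
empty sum; (iii) `rm_zero` — likewise the remainders «Σ_{j=0}^{k−1} O((L^jε)^{3+κ₀})|T₁^{(j)}|»; (iv) `fl_le_exp_logFl` — the
integral of (58)₀ IS the fluctuation integral of (22) p. 261 L22–24 «∫dμ_{C^{(0)}(Ω₁,U₁)}(A)χ exp[v(g₀A) − (1/g₀²)Ṽ(g₀A)]», whose
logarithm LQB names `StepPieces.logFl` («the logarithm of the fluctuation integral (last factor of (22))») — typed `Fl55 ≤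
exp logFl` (equality for the canonical carrier).  A `Prop`-valued contract; nothing constructed. [folklore] -/
structure Step0Displays (S : StepDisplays T 0) : Prop where
  /-- (58)₀: no previous-scale interaction terms -/
  pold_zero : ∀ (h : T.Hist 1) (V : T.Cfg 1), S.Pold h V = 0
  /-- (41)₀: no Z-terms at the projected (k = 0) history -/
  zterm_proj_zero : ∀ h : T.Hist 1, T.Zterm 0 (S.proj h) = 0
  /-- (41)₀: no remainder -/
  rm_zero : T.Rm 0 = 0
  /-- (58)₀ = (22): the integral is the fluctuation integral, `Fl55 ≤ exp logFl` -/
  fl_le_exp_logFl : ∀ (h : T.Hist 1) (V : T.Cfg 1), S.Fl55 h V ≤ Real.exp (S.logFl h V)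

/-- If the k = 0 histories form one point (so every projection is the trivial history) the Z-term clause follows from LQB's
carrier axiom `T.Zterm_triv`. [folklore] -/
theorem zterm_proj_zero_of_subsingleton (S : StepDisplays T 0) [Subsingleton (T.Hist 0)] (h : T.Hist 1) :
    T.Zterm 0 (S.proj h) = 0 := by
  rw [Subsingleton.elim (S.proj h) (T.triv 0)]
  exact T.Zterm_triv 0

/-- **(58) at k = 0 is an identity**: `Fl55 ≤ exp(Pold + (Zterm₀∘proj + Rm₀))·exp logFl` with all three terms 0.
Re-derived bookkeeping. [cite: Balaban1985UV3, (58) p.270 + (22) p.261] -/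
theorem ineq58_step0 {S : StepDisplays T 0} (D : Step0Displays S) : Ineq58 S := by
  intro h V
  rw [D.pold_zero, D.zterm_proj_zero, D.rm_zero]
  simpa using D.fl_le_exp_logFl h V

/-- **LQB's leaf `Bound55` at k = 0 (= (22) p. 261) from the two Sect. A displays**: (8)–(10) (`Ineq48_49 S` at k = 0) and
(13)–(22) (`Ineq55 S γ` at k = 0, «g₀ sufficiently small» = `T.g 0 ≤ γ`), via the spine's `SectC.bound55_of_displays` with
(58)₀ discharged by `ineq58_step0`.  Re-derived bookkeeping; the two displays remain to be proved for the concrete carriers.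
[cite: Balaban1985UV3, (22) p.261] -/
theorem bound55_step0_of_displays {S : StepDisplays T 0} (D : Step0Displays S) {γ : ℝ} (hγ : T.g 0 ≤ γ)
    (h8_10 : Ineq48_49 S) (h13_22 : Ineq55 S γ) : Bound55 S.toStepPieces :=
  bound55_of_displays S hγ h8_10 h13_22 (ineq58_step0 D)

/-- The same with (41)₀ supplied (e.g. by `…SectAFirstStep.step0_of_data`): the k = 0 upper bound of (22) as printed,
`ρ₁(V) ≤ LF₁(V)(h ↦ −mainT₁ − E₀ + (log σ₀ + d(𝔤) log g₀)|Ω₁*| + log Z^{(0)}(Ω₁, U₁) + logFl)` (the `Pold`, Z- and remainder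
slots of LQB's exponent being 0).  Re-derived bookkeeping. [cite: Balaban1985UV3, (22) p.261] -/
theorem ineq22_of_displays {S : StepDisplays T 0} (D : Step0Displays S) {γ : ℝ} (hγ : T.g 0 ≤ γ)
    (h8_10 : Ineq48_49 S) (h13_22 : Ineq55 S γ) (h41 : Ineq41 T 0) (V : T.Cfg 1) :
    T.ρ 1 V ≤ T.LF 1 V (fun h => -(T.mainT 1 h V) - T.Ecst 0
      + (S.logσ₀ + S.dg * Real.log (T.g 0)) * S.starB h + S.logZU h V + S.logFl h V) := by
  have hB := bound55_step0_of_displays D hγ h8_10 h13_22 h41 V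
  refine hB.trans (le_of_eq ?_)
  congr 1
  funext h
  rw [D.pold_zero, D.zterm_proj_zero, D.rm_zero]
  ring

end Summit.QuantumFields.Balaban3D.Proofs.SectABound55
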